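import Literature.AlgebraicGeometry.Motives.PoincareUniversal.DualNumberRigid
import HarnessLib

/-!
# First-order rigidity of the Poincaré sheaf on the `Â` side (M13 node N3, γ8 bridge)

Cell hodgecm-mathlib, author B-p07 (g12).  For an abelian variety `A₀` over `ℂ` with ample `Θ`, `Â = A₀.dualOf Θ hΘ` and a
module `𝒫` on `A₀ × Â` with `(1 × φ_Θ)^*𝒫 ≅ Λ(𝒪(Θ))` (the Mumford sheaf): **a `ℂ[ε]`-point `w` of `Â` along which `𝒫`
restricts to a CONSTANT first-order deformation (`(A₀ ◁ w)^*𝒫 ≅ pr₁^*N`, `N` of rank one on `A₀`) is constant**,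
`w = toUnit ≫ y`.  Lift `w = w′ ≫ φ_Θ` along the étale isogeny `φ_Θ` (★ `exists_lift_dualNumber_phiTheta`), transport the
isomorphism to `(A₀ ◁ w′)^*Λ(𝒪(Θ)) ≅ pr₁^*N` (★ `whiskerLeft_phiTheta_left_eq`, `Scheme.Modules.pullbackComp`), apply
«`Lie K(Θ) = 0`» (★ `eq_toUnit_comp_of_pullback_mumfordSheaf_iso`, `PoincareUniversal/DualNumberRigid`), push down by `φ_Θ`.
This is the hypothesis `hrig` of `PoincareUniversal/KodairaSpencerInjective.ksLinear_injective_of_rigid`.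
[MumfordAV1970] §13 (proof of the Theorem pp. 125–130).  HC_CM is proved only modulo the 7 printed citations until rung 0 closes.

## References
* [MumfordAV1970] D. Mumford, *Abelian Varieties* (1970), §13 (proof of the Thm. pp. 125–130), §7 Thm. 4.
* [Lange2023AbelianVarietiesComplex] H. Lange, *Abelian Varieties over the Complex Numbers* (2023), §1.4.4 Thm. 1.4.15 (p. 43).
-/

noncomputable section

open CategoryTheory CategoryTheory.Limits AlgebraicGeometry MonoidalCategory CartesianMonoidalCategory

namespace Literature.AlgebraicGeometry.Motives.AbelianVariety

section Gamma8Bridge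

open Literature.AlgebraicGeometry.AbelianSchemes Literature.AlgebraicGeometry.AbelianVarieties
  Literature.AlgebraicGeometry.Modules

variable (A₀ : AbelianVariety ℂ) {Θ : CartierDivisor A₀.X.left} (hΘ : Θ.IsAmple)
  (P : (A₀.X ⊗ (A₀.dualOf Θ hΘ).X).left.Modules)

/-- **FIRST-ORDER RIGIDITY OF THE POINCARÉ SHEAF ON THE `Â` SIDE** (the `hrig` hypothesis of γ8): a `ℂ[ε]`-point `w` of `Â`
with `(A₀ ◁ w)^*𝒫 ≅ pr₁^*N` for a rank-one `N` on `A₀` is constant, `w = toUnit ≫ y` — r1 (étale lift through `φ_Θ`) +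
`(1 × φ_Θ)^*𝒫 ≅ Λ(𝒪(Θ))` + «`Lie K(Θ) = 0`».
[cite: MumfordAV1970, §13 (proof of the Thm. pp. 125–130)] [cite: Lange2023AbelianVarietiesComplex, §1.4.4 Thm. 1.4.15 (p. 43)] -/
theorem poincare_firstOrderRigid
    (eP : Nonempty ((Scheme.Modules.pullback (AbelianVariety.Hom.toSchemeHom (A₀.oneProdPhiTheta hΘ))).obj P ≅
      mumfordSheaf A₀ Θ))
    (w : dualNumberOver ⟶ (A₀.dualOf Θ hΘ).X) (N : A₀.X.left.Modules) (hN : HasRank N 1)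
    (hw : Nonempty ((Scheme.Modules.pullback (A₀.X ◁ w).left).obj P ≅
      (Scheme.Modules.pullback (CartesianMonoidalCategory.fst A₀.X dualNumberOver).left).obj N)) :
    ∃ y : 𝟙_ (SchemeOver ℂ) ⟶ (A₀.dualOf Θ hΘ).X, w = toUnit _ ≫ y := by
  obtain ⟨ψ⟩ := hw
  obtain ⟨e⟩ := eP
  -- r1: lift `w` along `φ_Θ`
  obtain ⟨w', hw'⟩ := exists_lift_dualNumber_phiTheta A₀ hΘ w
  set φ := (A₀.phiTheta Θ hΘ).hom.hom.hom with hφ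
  -- `(A₀ ◁ w).left = (A₀ ◁ w').left ≫ (1 × φ_Θ)`
  have hcomp : (A₀.X ◁ w).left = (A₀.X ◁ w').left ≫ (A₀.X ◁ φ).left := by
    rw [← hw', MonoidalCategory.whiskerLeft_comp, Over.comp_left]
  have eφ : (Scheme.Modules.pullback (A₀.X ◁ φ).left).obj P ≅ mumfordSheaf A₀ Θ :=
    eqToIso (congrArg (fun k : (A₀.X ⊗ A₀.X).left ⟶ (A₀.X ⊗ (A₀.dualOf Θ hΘ).X).left =>
      (Scheme.Modules.pullback k).obj P) (whiskerLeft_phiTheta_left_eq A₀ hΘ)) ≪≫ e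
  -- `(A₀ ◁ w')^*Λ(𝒪(Θ)) ≅ (A₀ ◁ w)^*𝒫 ≅ pr₁^*N`
  have eΛ : (Scheme.Modules.pullback (A₀.X ◁ w').left).obj (mumfordSheaf A₀ Θ) ≅
      (Scheme.Modules.pullback (CartesianMonoidalCategory.fst A₀.X dualNumberOver).left).obj N :=
    ((Scheme.Modules.pullback (A₀.X ◁ w').left).mapIso eφ).symm ≪≫
      ((Scheme.Modules.pullbackComp (A₀.X ◁ w').left (A₀.X ◁ φ).left).app P) ≪≫
      eqToIso (congrArg (fun k => (Scheme.Modules.pullback k).obj P) hcomp).symm ≪≫ ψ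
  -- «Lie K(Θ) = 0»: `w'` is constant; push down by `φ_Θ`
  obtain ⟨x, hx⟩ := eq_toUnit_comp_of_pullback_mumfordSheaf_iso A₀ hΘ w' N hN ⟨eΛ⟩
  refine ⟨x ≫ φ, ?_⟩
  rw [← hw', hx, Category.assoc]

end Gamma8Bridge

end Literature.AlgebraicGeometry.Motives.AbelianVariety

end
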